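import Literature.Analysis.FluidPDE.GaussianVortexCellProblem
import Literature.Analysis.FluidPDE.BiotSavart2DModeTwo
import Literature.Analysis.FluidPDE.GallayWayneProfileWeight
import Literature.Analysis.FunctionSpaces.GaussianSchwartz
import HarnessLib

/-!
# Proof of Gallay–Wayne 2006, Proposition 3.1 (the cell problem `Λ w_∞ = 𝓜G`)

We discharge the named fact `Literature.Analysis.FluidPDE.GallayWayne2006_prop31`: there is a
real Schwartz function `w_∞` on `ℝ²` with

  `v^G·∇w_∞ + (K_{2D} ∗ w_∞)·∇G = −¼ (x₀² − x₁²) G`.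

## The printed proof and this formalization

Gallay–Wayne (§3, (3.2)–(3.9)) look for `w_∞ = ω(r) sin 2θ = (2x₀x₁/r²) ω(r)`; the stream
function is then `Ω(r) sin 2θ` with `Ω` solving the radial ODE (3.6), `ω = h(Ω − r²/4)`
((3.5), `h(r) = G/(2(v^G)_θ/r)… = (r²/4)/(e^{r²/4} − 1)`), and (3.6) is solved by variation of
constants ((3.9)) plus ODE asymptotics (Coddington–Levinson) to get `Ω` decaying at `0` and `∞`.

Here the same solution is produced in the variable `t = r² = |x|²` and in fixed-point form, which
avoids ODE asymptotics:

* `w_∞(x) = x₀x₁ a(|x|²)` with `a = h̃ (E − ½)`, `h̃(t) = (t/4)/(e^{t/4} − 1) = 1/φ(−t/4)`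
  (`φ = burgersPhi`), where `E` (which is `2Ω/r²` up to normalisation) solves the integral form
  of (3.6)/(3.9):
  `E(t) = ⅛ (t⁻² ∫₀ᵗ u² a(u) du + ∫ₜ^∞ a(u) du)`
  — existence, boundedness and temperate growth of `E` are
  `Literature.Analysis.FluidPDE.exists_gallayWayne_streamCoeff` (a contraction on bounded
  continuous functions, `GallayWayneProfileExistence`, and a bootstrap, `GallayWayneProfileRegularity`);
* the nonlocal term: for a mode-two vorticity `x₀x₁a(|x|²)` the Biot–Savart velocity satisfies
  `x·(K ∗ w)(x) = (x₀² − x₁²) ⅛ (t⁻² ∫₀ᵗ u² a + ∫ₜ^∞ a)` (explicit Green's function of the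
  mode-two radial Laplacian; `Literature.Analysis.FluidPDE.inner_self_biotSavart2D_modeTwo`), and
  `∇G = −(x/2) G`, so `(K ∗ w_∞)·∇G = −(G/2)(x₀² − x₁²) E(t)`;
* the transport term: `v^G = (8π)⁻¹ φ(t/4) x^⊥` and `x^⊥·∇(x₀x₁ a(|x|²)) = (x₀² − x₁²) a(t)`, so
  `v^G·∇w_∞ = (8π)⁻¹ φ(t/4) (x₀² − x₁²) h̃(t) (E(t) − ½) = (8π)⁻¹ e^{−t/4} (x₀² − x₁²)(E(t) − ½)`
  because `φ(t/4) h̃(t) = φ(t/4)/φ(−t/4) = e^{−t/4}` (`burgersPhi_neg`);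
* summing, the `E`-terms cancel ((3.4)–(3.5) in the paper) and what is left is
  `−(8π)⁻¹ e^{−t/4} (x₀² − x₁²)/2 = −¼ (x₀² − x₁²) G`;
* `w_∞ ∈ 𝒮`: `w_∞ = N · e^{−|x|²/4}` with the temperate multiplier
  `N(x) = x₀x₁ φ(|x|²/4)⁻¹ (E(|x|²) − ½)` (`hasTemperateGrowth_inv_burgersPhi`, temperate growth of
  `E`), via `SchwartzMap.smulLeftCLM` and the Gaussian Schwartz function
  `Literature.Analysis.FunctionSpaces.realGaussianSchwartz`.

## Main statement

* `GallayWayne2006_prop31_holds : GallayWayne2006_prop31`.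

## References

* Th. Gallay, C. E. Wayne, *Existence and stability of asymmetric Burgers vortices*, J. Math.
  Fluid Mech. 9 (2007) 243–261 = arXiv:math/0503353, §3, Proposition 3.1. [GallayWayne2006]
-/

noncomputable section

open Set Filter MeasureTheory
open scoped Topology RealInnerProductSpace SchwartzMap

namespace Literature.Analysis.FluidPDE

/-- `φ(s)/φ(−s) = e^{−s}` (from `φ(−s) = eˢ φ(s)`): the identity `φ(t/4) h̃(t) = e^{−t/4}` behind
the cancellation (3.4)–(3.5) of Gallay–Wayne 2006. [cite: GallayWayne2006, §3 (3.5)] -/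
theorem burgersPhi_mul_inv_burgersPhi_neg (s : ℝ) :
    burgersPhi s * (burgersPhi (-s))⁻¹ = Real.exp (-s) := by
  have hφ : burgersPhi s ≠ 0 := (burgersPhi_pos s).ne'
  rw [burgersPhi_neg, mul_inv, mul_left_comm, mul_inv_cancel₀ hφ, mul_one, Real.exp_neg]

/-- **The directional derivative of the mode-two ansatz along `x^⊥`**:
`x^⊥ · ∇(x₀x₁ a(|x|²)) = (x₀² − x₁²) a(|x|²)` for differentiable `a`. [folklore] -/
theorem fderiv_modeTwo_apply_perp {a : ℝ → ℝ} (ha : Differentiable ℝ a)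
    (ξ : EuclideanSpace ℝ (Fin 2)) :
    fderiv ℝ (fun x : EuclideanSpace ℝ (Fin 2) => x 0 * x 1 * a (‖x‖ ^ 2)) ξ (perp ξ) =
      (ξ 0 ^ 2 - ξ 1 ^ 2) * a (‖ξ‖ ^ 2) := by
  have h0 : HasFDerivAt (fun x : EuclideanSpace ℝ (Fin 2) => x 0)
      (EuclideanSpace.proj (𝕜 := ℝ) (0 : Fin 2)) ξ :=
    (EuclideanSpace.proj (𝕜 := ℝ) (0 : Fin 2)).hasFDerivAt
  have h1 : HasFDerivAt (fun x : EuclideanSpace ℝ (Fin 2) => x 1)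
      (EuclideanSpace.proj (𝕜 := ℝ) (1 : Fin 2)) ξ :=
    (EuclideanSpace.proj (𝕜 := ℝ) (1 : Fin 2)).hasFDerivAt
  have hn := (hasStrictFDerivAt_norm_sq ξ).hasFDerivAt
  have hcomp := (ha (‖ξ‖ ^ 2)).hasDerivAt.comp_hasFDerivAt ξ hn
  have hf : HasFDerivAt (fun x : EuclideanSpace ℝ (Fin 2) => x 0 * x 1 * a (‖x‖ ^ 2)) _ ξ :=
    (h0.fun_mul h1).fun_mul hcomp
  rw [hf.fderiv]
  simp [innerSL_apply_apply, inner_perp_self_right]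
  ring

/-- **Gallay–Wayne 2006, Proposition 3.1** (`∃ w_∞ ∈ 𝒮(ℝ²)`, `Λ w_∞ = 𝓜G`), proved:
`w_∞(x) = x₀x₁ h̃(|x|²)(E(|x|²) − ½)` with `E` the stream coefficient of
`Literature.Analysis.FluidPDE.exists_gallayWayne_streamCoeff`. [cite: GallayWayne2006, Prop. 3.1] -/
theorem GallayWayne2006_prop31_holds : GallayWayne2006_prop31 := by
  obtain ⟨E, hEt, ⟨B, hB⟩, hfix⟩ := exists_gallayWayne_streamCoeff
  have hEc : Continuous E := hEt.1.continuous
  have hEd : Differentiable ℝ E := hEt.1.differentiable (by simp)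
  have hic : Continuous fun s : ℝ => (burgersPhi s)⁻¹ := (contDiff_inv_burgersPhi (n := 0)).continuous
  have hid : Differentiable ℝ fun s : ℝ => (burgersPhi s)⁻¹ :=
    (contDiff_inv_burgersPhi (n := 1)).differentiable (by simp)
  -- the radial vorticity profile `a = h̃ (E - 1/2)` of `w_∞ = x₀x₁ a(|x|²)` ((3.5))
  obtain ⟨a, ha⟩ : ∃ a : ℝ → ℝ, a = fun u => (burgersPhi (-(u / 4)))⁻¹ * (E u - 1 / 2) := ⟨_, rfl⟩
  have hac : Continuous a := by
    rw [ha]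
    exact (hic.comp (by fun_prop : Continuous fun u : ℝ => -(u / 4))).mul
      (hEc.sub continuous_const)
  have had : Differentiable ℝ a := by
    rw [ha]
    exact (hid.comp (by fun_prop : Differentiable ℝ fun u : ℝ => -(u / 4))).mul
      (hEd.sub (differentiable_const _))
  have haC : ∀ t, 0 ≤ t → |a t| ≤ (B + 1 / 2) * Real.exp (-(t / 8)) := by
    intro t ht
    simp only [ha]
    rw [abs_mul, abs_of_nonneg (inv_burgersPhi_neg_nonneg t), mul_comm (B + 1 / 2)]
    have hEB : |E t - 1 / 2| ≤ B + 1 / 2 :=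
      calc |E t - 1 / 2| ≤ |E t| + |(1 / 2 : ℝ)| := abs_sub _ _
        _ ≤ B + 1 / 2 := by rw [abs_of_pos (by norm_num : (0 : ℝ) < 1 / 2)]; linarith [hB t]
    exact mul_le_mul (inv_burgersPhi_neg_le_exp_neg ht) hEB (abs_nonneg _) (Real.exp_pos _).le
  -- the temperate multiplier `N` with `w_∞ = N · e^{-|x|²/4}`
  obtain ⟨N, hN⟩ : ∃ N : EuclideanSpace ℝ (Fin 2) → ℝ, N = fun x =>
      x 0 * x 1 * ((burgersPhi (‖x‖ ^ 2 / 4))⁻¹ * (E (‖x‖ ^ 2) - 1 / 2)) := ⟨_, rfl⟩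
  have hNt : N.HasTemperateGrowth := by
    have h0 : Function.HasTemperateGrowth fun x : EuclideanSpace ℝ (Fin 2) => x 0 :=
      (EuclideanSpace.proj (𝕜 := ℝ) (0 : Fin 2)).hasTemperateGrowth
    have h1 : Function.HasTemperateGrowth fun x : EuclideanSpace ℝ (Fin 2) => x 1 :=
      (EuclideanSpace.proj (𝕜 := ℝ) (1 : Fin 2)).hasTemperateGrowth
    have hn : Function.HasTemperateGrowth fun x : EuclideanSpace ℝ (Fin 2) => ‖x‖ ^ 2 :=
      Function.hasTemperateGrowth_norm_sq _
    have hn4 : Function.HasTemperateGrowth fun x : EuclideanSpace ℝ (Fin 2) => ‖x‖ ^ 2 / 4 := by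
      have e : (fun x : EuclideanSpace ℝ (Fin 2) => ‖x‖ ^ 2 / 4) =
          fun x => (1 / 4 : ℝ) * ‖x‖ ^ 2 := by
        funext x; ring
      rw [e]
      exact (Function.HasTemperateGrowth.const _).mul hn
    have hφ : Function.HasTemperateGrowth fun x : EuclideanSpace ℝ (Fin 2) =>
        (burgersPhi (‖x‖ ^ 2 / 4))⁻¹ :=
      hasTemperateGrowth_inv_burgersPhi.comp hn4
    have hE' : Function.HasTemperateGrowth fun x : EuclideanSpace ℝ (Fin 2) => E (‖x‖ ^ 2) :=
      hEt.comp hn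
    rw [hN]
    exact (h0.mul h1).mul (hφ.mul (hE'.sub (Function.HasTemperateGrowth.const _)))
  -- `w_∞ = N · e^{-|x|²/4} = x₀x₁ a(|x|²)`
  have hw : ⇑(SchwartzMap.smulLeftCLM ℝ N
      (FunctionSpaces.realGaussianSchwartz (EuclideanSpace ℝ (Fin 2)) (1 / 4))) =
        fun x => x 0 * x 1 * a (‖x‖ ^ 2) := by
    rw [SchwartzMap.smulLeftCLM_apply hNt]
    funext x
    rw [FunctionSpaces.realGaussianSchwartz_apply (by norm_num : (0 : ℝ) < 1 / 4), smul_eq_mul]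
    simp only [hN, ha]
    have hφ : burgersPhi (‖x‖ ^ 2 / 4) ≠ 0 := (burgersPhi_pos _).ne'
    have e1 : (burgersPhi (-(‖x‖ ^ 2 / 4)))⁻¹ =
        Real.exp (-(‖x‖ ^ 2 / 4)) * (burgersPhi (‖x‖ ^ 2 / 4))⁻¹ := by
      rw [← burgersPhi_mul_inv_burgersPhi_neg (‖x‖ ^ 2 / 4), mul_right_comm, mul_inv_cancel₀ hφ,
        one_mul]
    rw [e1, show -(1 / 4 : ℝ) * ‖x‖ ^ 2 = -(‖x‖ ^ 2 / 4) by ring]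
    ring
  refine ⟨SchwartzMap.smulLeftCLM ℝ N
    (FunctionSpaces.realGaussianSchwartz (EuclideanSpace ℝ (Fin 2)) (1 / 4)), fun ξ => ?_⟩
  rw [hw]
  -- the transport term `v^G·∇w_∞ = (8π)⁻¹ φ(t/4) (x₀² - x₁²) a(t)`
  have T1 : ⟪gaussVortexVelocity ξ,
      gradient (fun x : EuclideanSpace ℝ (Fin 2) => x 0 * x 1 * a (‖x‖ ^ 2)) ξ⟫ =
        (8 * Real.pi)⁻¹ * burgersPhi (‖ξ‖ ^ 2 / 4) * ((ξ 0 ^ 2 - ξ 1 ^ 2) * a (‖ξ‖ ^ 2)) := by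
    rw [real_inner_comm, gradient, InnerProductSpace.toDual_symm_apply, gaussVortexVelocity,
      map_smul, smul_eq_mul, fderiv_modeTwo_apply_perp had ξ]
  -- the nonlocal term `(K ∗ w_∞)·∇G = -(G/2) (x₀² - x₁²) E(t)`
  have T2 : ⟪biotSavart2D (fun x : EuclideanSpace ℝ (Fin 2) => x 0 * x 1 * a (‖x‖ ^ 2)) ξ,
      gradient gaussVortexProfile ξ⟫ =
        -(gaussVortexProfile ξ / 2) * ((ξ 0 ^ 2 - ξ 1 ^ 2) * E (‖ξ‖ ^ 2)) := by
    rw [real_inner_comm, gradient, InnerProductSpace.toDual_symm_apply,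
      fderiv_gaussVortexProfile_apply, inner_self_biotSavart2D_modeTwo hac haC ξ,
      hfix (‖ξ‖ ^ 2) (sq_nonneg _)]
    simp only [ha]
  rw [T1, T2, gaussVortexProfile]
  -- the cancellation (3.4)–(3.5): `φ(t/4) a(t) = e^{-t/4} (E(t) - 1/2)`
  have key : burgersPhi (‖ξ‖ ^ 2 / 4) * a (‖ξ‖ ^ 2) =
      Real.exp (-(‖ξ‖ ^ 2 / 4)) * (E (‖ξ‖ ^ 2) - 1 / 2) := by
    simp only [ha]
    rw [← mul_assoc, burgersPhi_mul_inv_burgersPhi_neg]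
  linear_combination (8 * Real.pi)⁻¹ * (ξ 0 ^ 2 - ξ 1 ^ 2) * key

end Literature.Analysis.FluidPDE
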